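import Literature.AlgebraicTopology.SingularHomology.RelativeCochainsMaps
import Literature.AlgebraicTopology.SingularHomology.CohomologyRingChange
import HarnessLib

/-!
# Change of coefficient ring in relative singular cohomology; naturality of the coboundary

A. Hatcher, *Algebraic Topology* (2002), §3.1 p. 198 ("change of coefficients": a ring
homomorphism `f : R → S` acts on cochains by composition, `φ ↦ f ∘ φ`, commuting with `δ`) and
pp. 199–200 (the long exact sequence of the pair `(X, A)` is natural). The tree's change of
coefficients `singularCohomology.ringChange f X n : Hⁿ(X; R) →+ Hⁿ(X; S)` (`CohomologyRingChange.lean`)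
is built by hand on cocycles, the two cohomology groups living in different categories
(`ModuleCat R`, `ModuleCat S`). This file does the same for the RELATIVE groups
`relSingularCohomology R R X A n = Hⁿ(X, A; R)` (`RelativeCochains.lean`) and proves that the three
maps of the long exact sequence commute with the change of coefficients:

* `singularCohomology.ringChange_homologyCls` — `f_*[z] = [f ∘ z]` on classes of cochains `z` with
  `δz = 0` (the `homologyCls` form of `ringChange_π`);
* `relCochainComplex.ringChangeX f A n : Cⁿ(X, A; R) →+ Cⁿ(X, A; S)`, `φ ↦ f ∘ φ` (a cochain vanishing
  on the simplices of `A` still does), commuting with `δ` (`ringChangeX_d`);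
* **`relSingularCohomology.ringChange f X A n : Hⁿ(X, A; R) →+ Hⁿ(X, A; S)`**, `[z] ↦ [f ∘ z]`
  (`ringChange_homologyCls`), well defined because `f ∘ δw = δ(f ∘ w)`;
* naturality: **`ringChange_toAbsolute`** (`Hⁿ(X, A) → Hⁿ(X)`), **`ringChange_map`** (maps of pairs),
  and **`ringChange_δ`** (the coboundary `δ : Hⁱ(A) → Hⁱ⁺¹(X, A)`, computed on both sides by
  `relSingularCohomology.δ_homologyCls`: `δ[α] = [δβ]` for any extension `β` of `α`, and `f ∘ β`
  extends `f ∘ α`).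

Everything is proved; no named facts. Written for the change of coefficients in the Thom / Euler /
Chern classes of the tree (`CharacteristicClasses`), whose normalising generator
`ω ∈ H²(ℂP¹; R)` is produced by coboundaries of pairs.

## References

* A. Hatcher, *Algebraic Topology*, CUP 2002, §3.1 p. 198, pp. 199–200. [Hatcher2002]
-/

noncomputable section

open CategoryTheory

universe u v

namespace Literature.AlgebraicTopology.SingularHomology

open singularCochainComplex relCochainComplex

variable {R S : Type v} [CommRing R] [CommRing S] (f : R →+* S)
variable {X Y : Type u} [TopologicalSpace X] [TopologicalSpace Y]

/-! ### Absolute cohomology: `f_*` on classes of cochains -/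

/-- `δ(f ∘ z) = f ∘ δz` in the shape `d n (next n)` of the cochain complex. [cite: Hatcher2002, §3.1 p. 198] -/
lemma singularCochainComplex.d_next_comp_ringHom {n : ℕ} (z : SingularSimplex X n → R) :
    ((singularCochainComplex S S X).d n ((ComplexShape.up ℕ).next n) (f ∘ z) :
        SingularSimplex X ((ComplexShape.up ℕ).next n) → S) =
      f ∘ ((singularCochainComplex R R X).d n ((ComplexShape.up ℕ).next n) z :
        SingularSimplex X ((ComplexShape.up ℕ).next n) → R) := by
  rw [CochainComplex.next]
  exact coboundary_comp_ringHom f z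

/-- A cochain with `δz = 0` still has `δ(f ∘ z) = 0`. [cite: Hatcher2002, §3.1 p. 198] -/
lemma singularCochainComplex.d_next_comp_ringHom_eq_zero {n : ℕ} {z : SingularSimplex X n → R}
    (hz : (singularCochainComplex R R X).d n ((ComplexShape.up ℕ).next n) z = 0) :
    (singularCochainComplex S S X).d n ((ComplexShape.up ℕ).next n) (f ∘ z) = 0 := by
  have h := singularCochainComplex.d_next_comp_ringHom f z
  rw [hz] at h
  rw [h]
  funext σ
  exact map_zero f

/-- **`f_*[z] = [f ∘ z]`** for a cochain `z` with `δz = 0` (Hatcher 2002, §3.1 p. 198), the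
`homologyCls` form of `singularCohomology.ringChange_π`. [cite: Hatcher2002, §3.1 p. 198] -/
theorem singularCohomology.ringChange_homologyCls {n : ℕ} (z : (singularCochainComplex R R X).X n)
    (hz : (singularCochainComplex R R X).d n ((ComplexShape.up ℕ).next n) z = 0)
    (hfz : (singularCochainComplex S S X).d n ((ComplexShape.up ℕ).next n) (f ∘ z : SingularSimplex X n → S) = 0) :
    singularCohomology.ringChange f X n (homologyCls z hz) =
      homologyCls (K := singularCochainComplex S S X) (f ∘ z : SingularSimplex X n → S) hfz := by
  have hz' : (singularCochainComplex R R X).d n (n + 1) z = 0 := by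
    rw [← CochainComplex.next ℕ n]; exact hz
  have hfz' : (singularCochainComplex S S X).d n (n + 1) (f ∘ z : SingularSimplex X n → S) = 0 := by
    rw [← CochainComplex.next ℕ n]; exact hfz
  have e1 : homologyCls z hz = singularCohomology.π R R X n (cocyclesMk (z : SingularSimplex X n → R) hz') :=
    homologyCls_eq_homologyπ_cyclesMk (K := singularCochainComplex R R X) z hz (n + 1) (CochainComplex.next ℕ n) hz'
  have e2 : homologyCls (K := singularCochainComplex S S X) (f ∘ z : SingularSimplex X n → S) hfz =
      singularCohomology.π S S X n (cocyclesMk (f ∘ z : SingularSimplex X n → S) hfz') :=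
    homologyCls_eq_homologyπ_cyclesMk (K := singularCochainComplex S S X) _ hfz (n + 1) (CochainComplex.next ℕ n) hfz'
  rw [e1, e2, singularCohomology.ringChange_π]
  congr 1
  refine coFn_injective ?_
  rw [coFn_cocyclesRingChange, coFn_cocyclesMk, coFn_cocyclesMk]

/-! ### Relative cochains: `φ ↦ f ∘ φ` -/

namespace relCochainComplex

variable {A : Set X} {n : ℕ}

/-- A relative cochain composed with `f` is a relative cochain (it still vanishes on the simplices
of `A`). [cite: Hatcher2002, §3.1 p. 199] -/
lemma comp_mem_relCochains {φ : SingularSimplex X n → R} (hφ : φ ∈ relCochains R R A n) :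
    (f ∘ φ : SingularSimplex X n → S) ∈ relCochains S S A n := fun σ hσ ↦ by
  rw [Function.comp_apply, hφ σ hσ, map_zero]

/-- **Change of ring on relative cochains** `Cⁿ(X, A; R) →+ Cⁿ(X, A; S)`, `φ ↦ f ∘ φ`.
[cite: Hatcher2002, §3.1 p. 198] -/
def ringChangeX (A : Set X) (n : ℕ) : (relCochainComplex R R A).X n →+ (relCochainComplex S S A).X n where
  toFun φ := mk (f ∘ val φ) (comp_mem_relCochains f (val_mem φ))
  map_zero' := val_injective (funext fun _ ↦ map_zero f)
  map_add' _ _ := val_injective (funext fun _ ↦ map_add f _ _)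

/-- `val (f_* φ) = f ∘ val φ`. [cite: Hatcher2002, §3.1 p. 198] -/
@[simp] lemma val_ringChangeX (φ : (relCochainComplex R R A).X n) :
    val (ringChangeX f A n φ) = f ∘ val φ := rfl

/-- `f_*` commutes with the relative coboundary (any shape `d m k`). [cite: Hatcher2002, §3.1 p. 198] -/
lemma ringChangeX_d (m k : ℕ) (φ : (relCochainComplex R R A).X m) :
    ringChangeX f A k ((relCochainComplex R R A).d m k φ) =
      (relCochainComplex S S A).d m k (ringChangeX f A m φ) := by
  apply val_injective
  rw [val_ringChangeX, val_d', val_d', val_ringChangeX]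
  by_cases h : m + 1 = k
  · subst h
    exact (coboundary_comp_ringHom f (val φ)).symm
  · rw [(singularCochainComplex R R X).shape m k h, (singularCochainComplex S S X).shape m k h]
    funext σ
    exact map_zero f

/-- `f_*` sends relative cocycles to relative cocycles. [cite: Hatcher2002, §3.1 p. 198] -/
lemma d_ringChangeX_eq_zero {m k : ℕ} {z : (relCochainComplex R R A).X m}
    (hz : (relCochainComplex R R A).d m k z = 0) :
    (relCochainComplex S S A).d m k (ringChangeX f A m z) = 0 := by
  rw [← ringChangeX_d, hz, map_zero]

end relCochainComplex

/-! ### Relative cohomology: `f_* : Hⁿ(X, A; R) →+ Hⁿ(X, A; S)` -/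

namespace relSingularCohomology

variable {A : Set X} {n : ℕ}

/-- `f_*` on a relative class, through a chosen representative. [folklore] -/
def ringChangeCls (A : Set X) (n : ℕ) (x : relSingularCohomology R R X A n) : relSingularCohomology S S X A n :=
  homologyCls (K := relCochainComplex S S A) (ringChangeX f A n (homologyCls_surjective x).choose)
    (d_ringChangeX_eq_zero f (homologyCls_surjective x).choose_spec.choose)

/-- **`f_*` is well defined on relative classes**: cochains differing by a relative coboundary
`δw` have images differing by `δ(f ∘ w)`. [cite: Hatcher2002, §3.1 p. 198] -/
theorem homologyCls_ringChangeX_eq_of_homologyCls_eq {z z' : (relCochainComplex R R A).X n}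
    (hz : (relCochainComplex R R A).d n ((ComplexShape.up ℕ).next n) z = 0)
    (hz' : (relCochainComplex R R A).d n ((ComplexShape.up ℕ).next n) z' = 0)
    (h : homologyCls z hz = homologyCls z' hz') :
    homologyCls (K := relCochainComplex S S A) (ringChangeX f A n z) (d_ringChangeX_eq_zero f hz) =
      homologyCls (K := relCochainComplex S S A) (ringChangeX f A n z') (d_ringChangeX_eq_zero f hz') := by
  obtain ⟨w, hw⟩ := (homologyCls_eq_homologyCls_iff z z' hz hz').1 h
  refine (homologyCls_eq_homologyCls_iff _ _ _ _).2 ⟨ringChangeX f A _ w, ?_⟩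
  rw [← ringChangeX_d, hw, map_sub]

/-- `ringChangeCls f [z] = [f ∘ z]`. [cite: Hatcher2002, §3.1 p. 198] -/
theorem ringChangeCls_homologyCls (z : (relCochainComplex R R A).X n)
    (hz : (relCochainComplex R R A).d n ((ComplexShape.up ℕ).next n) z = 0) :
    ringChangeCls f A n (homologyCls z hz) =
      homologyCls (K := relCochainComplex S S A) (ringChangeX f A n z) (d_ringChangeX_eq_zero f hz) :=
  homologyCls_ringChangeX_eq_of_homologyCls_eq f _ hz
    (homologyCls_surjective (homologyCls z hz)).choose_spec.choose_spec

/-- **Change of coefficient ring in relative cohomology**: the additive map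
`f_* : Hⁿ(X, A; R) → Hⁿ(X, A; S)`, `[z] ↦ [f ∘ z]`, induced by a ring homomorphism `f : R → S`
(Hatcher 2002, §3.1 p. 198, for the pair `(X, A)`). [cite: Hatcher2002, §3.1 p. 198] -/
def ringChange (X : Type u) [TopologicalSpace X] (A : Set X) (n : ℕ) :
    relSingularCohomology R R X A n →+ relSingularCohomology S S X A n where
  toFun := ringChangeCls f A n
  map_zero' := by
    have h0 : (relCochainComplex R R A).d n ((ComplexShape.up ℕ).next n) 0 = 0 := map_zero _
    have e : (0 : relSingularCohomology R R X A n) =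
        homologyCls (K := relCochainComplex R R A) (0 : (relCochainComplex R R A).X n) h0 :=
      (homologyCls_zero h0).symm
    rw [e, ringChangeCls_homologyCls]
    exact (homologyCls_congr (map_zero (ringChangeX f A n)) _ (map_zero _)).trans (homologyCls_zero _)
  map_add' x y := by
    obtain ⟨z, hz, rfl⟩ := homologyCls_surjective x
    obtain ⟨z', hz', rfl⟩ := homologyCls_surjective y
    have hzz' : (relCochainComplex R R A).d n ((ComplexShape.up ℕ).next n) (z + z') = 0 := by
      rw [map_add, hz, hz', add_zero]
    have h3 : ringChangeCls f A n (homologyCls (z + z') hzz') =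
        ringChangeCls f A n (homologyCls z hz) + ringChangeCls f A n (homologyCls z' hz') := by
      rw [ringChangeCls_homologyCls, ringChangeCls_homologyCls, ringChangeCls_homologyCls]
      exact (homologyCls_congr (map_add (ringChangeX f A n) z z') _
        (by rw [map_add, d_ringChangeX_eq_zero f hz, d_ringChangeX_eq_zero f hz', add_zero])).trans
        (homologyCls_add _ _ (d_ringChangeX_eq_zero f hz) (d_ringChangeX_eq_zero f hz') _)
    exact (congrArg (ringChangeCls f A n) (homologyCls_add z z' hz hz' hzz').symm).trans h3

/-- **`f_*[z] = [f ∘ z]`** on relative classes. [cite: Hatcher2002, §3.1 p. 198] -/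
@[simp] theorem ringChange_homologyCls (z : (relCochainComplex R R A).X n)
    (hz : (relCochainComplex R R A).d n ((ComplexShape.up ℕ).next n) z = 0) :
    ringChange f X A n (homologyCls z hz) =
      homologyCls (K := relCochainComplex S S A) (ringChangeX f A n z) (d_ringChangeX_eq_zero f hz) :=
  ringChangeCls_homologyCls f z hz

/-! ### Naturality of `Hⁿ(X, A) → Hⁿ(X)`, of maps of pairs, and of the coboundary -/

/-- **`f_*` commutes with `j^* : Hⁿ(X, A) → Hⁿ(X)`.** [cite: Hatcher2002, §3.1 pp. 199–200] -/
theorem ringChange_toAbsolute (x : relSingularCohomology R R X A n) :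
    singularCohomology.ringChange f X n (toAbsolute R R X A n x) =
      toAbsolute S S X A n (ringChange f X A n x) := by
  obtain ⟨z, hz, rfl⟩ := homologyCls_surjective x
  rw [ringChange_homologyCls]
  change singularCohomology.ringChange f X n (HomologicalComplex.homologyMap (ι R R A) n (homologyCls z hz)) =
    HomologicalComplex.homologyMap (ι S S A) n _
  rw [homologyMap_homologyCls, homologyMap_homologyCls]
  exact singularCohomology.ringChange_homologyCls f (val z) _ _

/-- **`f_*` commutes with the maps `g^* : Hⁿ(Y, B) → Hⁿ(X, A)` of pairs.** [cite: Hatcher2002, §3.1 p. 200] -/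
theorem ringChange_map {B : Set Y} (g : C(X, Y)) (h : Set.MapsTo g A B) (x : relSingularCohomology R R Y B n) :
    ringChange f X A n (map R R g h n x) = map S S g h n (ringChange f Y B n x) := by
  obtain ⟨z, hz, rfl⟩ := homologyCls_surjective x
  rw [ringChange_homologyCls]
  change ringChange f X A n (HomologicalComplex.homologyMap (relCochainComplex.map R R g h) n (homologyCls z hz)) =
    HomologicalComplex.homologyMap (relCochainComplex.map S S g h) n _
  rw [homologyMap_homologyCls, homologyMap_homologyCls, ringChange_homologyCls]
  exact homologyCls_congr (val_injective rfl) _ _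

/-- A lift `β ∈ Cⁱ(X)` of a cocycle `α` of `A` has relative coboundary: `δβ ∈ Cʲ(X, A)`. [cite: Hatcher2002, §3.1 p. 200] -/
lemma d_mem_relCochains_of_lift {i j : ℕ} (hij : i + 1 = j) {T : Type v} [CommRing T]
    (α : SingularSimplex A i → T) (hα : (singularCochainComplex T T A).d i ((ComplexShape.up ℕ).next i) α = 0)
    (β : SingularSimplex X i → T) (hβ : (ρ T T A).f i β = α) :
    ((singularCochainComplex T T X).d i j β : SingularSimplex X j → T) ∈ relCochains T T A j := by
  refine mem_relCochains_of_ρ_eq_zero ?_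
  rw [← ModuleCat.comp_apply, ← (ρ T T A).comm, ModuleCat.comp_apply, hβ, ← (ComplexShape.up ℕ).next_eq' hij]
  exact hα

/-- **`f_*` commutes with the coboundary `δ : Hⁱ(A) → Hʲ(X, A)` of the pair** (`i + 1 = j`):
`f_*(δ[α]) = [f ∘ δβ] = [δ(f ∘ β)] = δ[f ∘ α]` for any extension `β` of `α` to `X`
(Hatcher 2002, §3.1 p. 200 with §2.1 p. 116). [cite: Hatcher2002, §3.1 p. 200] -/
theorem ringChange_δ {i j : ℕ} (hij : i + 1 = j) (a : singularCohomology R R A i) :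
    ringChange f X A j (δ R R X A i j hij a) = δ S S X A i j hij (singularCohomology.ringChange f A i a) := by
  obtain ⟨α, hα, rfl⟩ := homologyCls_surjective (K := singularCochainComplex R R A) a
  obtain ⟨β, hβ⟩ := ρ_f_surjective (R := R) (M := R) (A := A) (n := i) α
  have hdβ := d_mem_relCochains_of_lift hij α hα β hβ
  rw [δ_homologyCls hij α hα β hβ hdβ (d_mk_d_eq_zero β hdβ _), ringChange_homologyCls,
    singularCohomology.ringChange_homologyCls f α hα (singularCochainComplex.d_next_comp_ringHom_eq_zero f hα)]
  -- the lift `f ∘ β` of `f ∘ α`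
  have hβ' : (ρ S S A).f i (f ∘ β) = f ∘ α := by
    rw [← hβ]
    rfl
  have hdβ' := d_mem_relCochains_of_lift hij (f ∘ α) (singularCochainComplex.d_next_comp_ringHom_eq_zero f hα) (f ∘ β) hβ'
  rw [δ_homologyCls hij (f ∘ α) _ (f ∘ β) hβ' hdβ' (d_mk_d_eq_zero (f ∘ β) hdβ' _)]
  refine homologyCls_congr (val_injective ?_) _ _
  rw [val_ringChangeX, val_mk, val_mk]
  subst hij
  exact (coboundary_comp_ringHom f β).symm

end relSingularCohomology

end Literature.AlgebraicTopology.SingularHomology
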